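import Summits.ResolutionOfSingularities.ResolutionOfSingularities.Theorems.RadicialJungCleanModelsLens5TFrameModelInf
import Summits.ResolutionOfSingularities.ResolutionOfSingularities.Theorems.RadicialJungCleanModelsLens5TFrameTwoField3OfThm11
import HarnessLib

/-!
# RadicialJungCleanModelsLens5TFrameModelInf — re-threaded through Cossart–Piltant 2019 Thm. 1.1 (i)–(iii) (`_thm11` variants)

Route `RadicialJung`, crux `CleanModels` (stmt-ResolutionOfSingularities-15917), line `Sketch`.  The declarations below are the
tree's theorems of the same names WITHOUT the suffix `_thm11` (file `RadicialJungCleanModelsLens5TFrameModelInf.lean`), with the embedded-resolution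
HYPOTHESIS `hEmb` (CJS 2020 Cor. 1.5 shape; skeleton stub `stub_cjs2020Thm14` = F-32) REPLACED by the typed verbatim
Cossart–Piltant 2019 Thm. 1.1 (i)–(iii) `CP2019.CossartPiltant2019Thm11`, through the doubling trick
(`Doubling.hEmb_zeroLocus_of_thm11`, `exists_localRing_monomial_of_thm11_dim`).  Proof bodies are the tree's, verbatim — credit to
the original file and its authors (res-B-lens-5, res-B-lead-1 and workers); only the binder and the threaded call differ.  
OURS; nothing here proves resolution in characteristic `p`.
-/

set_option linter.dupNamespace false -- mandated namespace of this single-conjunct summit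

noncomputable section

section

open IsLocalRing
open Literature.AlgebraicGeometry.Resolution
open Summit.ResolutionOfSingularities.ResolutionOfSingularities.Theorems.RadicialJung.CleanModels
open Summit.ResolutionOfSingularities.ResolutionOfSingularities.Theorems.RadicialJung.CleanModels.Lens5
open Summit.ResolutionOfSingularities.ResolutionOfSingularities.Theorems.RadicialJung.CleanModels.Lens5.PRankTwoCurrency
open Summit.ResolutionOfSingularities.ResolutionOfSingularities.Theorems.RadicialJung.CleanModels.Lens5.PRankTwoAssembly
open Summit.ResolutionOfSingularities.ResolutionOfSingularities.Theorems.RadicialJungCleanModels.Lens5RegularityCriterion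
open Summit.ResolutionOfSingularities.ResolutionOfSingularities.Theorems.RadicialJungCleanModels.Lens5ChartSurjection

namespace Summit.ResolutionOfSingularities.ResolutionOfSingularities.Theorems.RadicialJungCleanModels.Lens5TFrame

open AlgebraicGeometry CategoryTheory in
/-- **PORT 2′_∞ (monomialising model over `k₀ = k^p`, ARBITRARY imperfect `k`).**  Same OUTPUT as `Lens5_TPrime.lean` rev 3 `port_monomialModel'`
(generators `G₂ ⊆ O`, the subring `C = k^p[G₂]`, `T := locAtCentre C O ⊆ M` with a regular system of parameters `z` monomialising `F`), but
WITHOUT the finite `p`-spanning family `b` of rev 3: instead of re-basing `A` to `k₀ := k^p` (which needs `[k : k^p] < ∞`), the two-field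
core `TwoField.port_monomialModel_core₂` keeps `A` a `k`-algebra and runs F-02 / F-32 on the `k^p`-side (`k^p(t^p, g₁) = K^p(g₀)` has
transcendence degree `3` over `k^p` for ANY `k`).  PROVED; consumes `hLU : LocalUniformization3 ↥(frobenius k p).fieldRange` and `hEmb`.
[cite: CossartPiltant2019, Thm. 1.1; CossartJannsenSaito2020, Thm. 1.6.3 (F-32)] -/
theorem port_monomialModelInf_thm11 (p : ℕ) [Fact p.Prime] {k : Type} [Field k] [CharP k p]
    {K : Type} [Field K] [Algebra k K] (hLU : LocalUniformization3 ↥(frobenius k p).fieldRange)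
    (h11 : Literature.AlgebraicGeometry.CossartPiltant200819.CP2019.CossartPiltant2019Thm11.{0})
    (O : ValuationSubring K) (A : Subalgebra k K)
    (hAO : A.toSubring ≤ O.toSubring) (hAfg : A.FG) [IsFractionRing A K] (hdimA : ringKrullDim A ≤ 3)
    (hdim3 : ringKrullDim (locAtCentre A.toSubring O) = 3)
    (hzd : ∀ (T : Subring K) (hT : T ≤ O.toSubring), A.toSubring ≤ T → (subringCentre T O hT).IsMaximal)
    (g₀ : K) (M : Subfield K) (hM : ∀ x : K, x ∈ M ↔ ∃ c : Fin p → K, ∑ j, c j ^ p * g₀ ^ (j : ℕ) = x)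
    (F : Finset K) (hFM : ∀ f ∈ F, f ∈ M) (hF0 : ∀ f ∈ F, f ≠ 0) :
    ∃ (G₂ : Finset K) (C : Subring K), (∀ g ∈ G₂, g ∈ O) ∧
      C = Subring.closure (Set.range (fun c : k => algebraMap k K c ^ p) ∪ (G₂ : Set K)) ∧
      (∀ a ∈ A, a ^ p ∈ C) ∧ (∀ r : K, r ∈ locAtCentre C O → r ∈ M) ∧
      ∃ (z : Fin 3 → K), (∀ i, z i ∈ locAtCentre C O) ∧ (∀ i, O.valuation (z i) < 1) ∧ (∀ i, z i ≠ 0) ∧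
        (∀ r : K, r ∈ locAtCentre C O → O.valuation r < 1 →
          ∃ b : Fin 3 → K, (∀ i, b i ∈ locAtCentre C O) ∧ r = ∑ i, b i * z i) ∧
        ∀ f ∈ F, ∃ (ε : K) (e : Fin 3 → ℤ), ε ∈ locAtCentre C O ∧ O.valuation ε = 1 ∧
          f = ε * ∏ i, z i ^ e i := by
  classical
  have hp : p.Prime := Fact.out
  haveI : CharP K p := charP_of_injective_algebraMap (algebraMap k K).injective p
  -- ## the small field `k₀ = k^p ⊆ k`, acting on `K` through `k`
  set k₀ : Subfield k := (frobenius k p).fieldRange with hk₀def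
  letI : Algebra k₀ K := Algebra.compHom K k₀.subtype
  haveI inst1 := IsScalarTower.of_algebraMap_eq (R := k₀) (S := k) (A := K) (fun _ => rfl)
  have halg₀ : ∀ c : k₀, algebraMap k₀ K c = algebraMap k K (c : k) := fun _ => rfl
  have hFrob : ∀ c : k, ∃ c₀ : k₀, algebraMap k₀ K c₀ = algebraMap k K c ^ p := fun c =>
    ⟨⟨c ^ p, RingHom.mem_fieldRange.mpr ⟨c, frobenius_def _ _⟩⟩, by rw [halg₀, map_pow]⟩
  have hk₀p : ∀ c₀ : k₀, ∃ d : K, algebraMap k₀ K c₀ = d ^ p := fun c₀ => by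
    obtain ⟨d, hd⟩ := RingHom.mem_fieldRange.mp c₀.2
    refine ⟨algebraMap k K d, ?_⟩
    rw [halg₀, ← map_pow, ← frobenius_def, hd]
  obtain ⟨t, ht⟩ := id hAfg
  -- ## the two-field core
  obtain ⟨A₂, hA₂O, hA₂fg, hAp, hR₂M, hreg₂, z₂, hspan₂, hdimR₂, hz0, hfac⟩ :=
    TwoField.port_monomialModel_core₂_thm11 p hFrob hk₀p hLU h11 O A hAO hAfg hdimA hdim3 hzd t ht g₀ M hM F hFM hF0
  haveI := hreg₂
  -- ## conversion to `K`-terms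
  obtain ⟨G₂, hG₂⟩ := hA₂fg
  have hC : A₂.toSubring = Subring.closure (Set.range (fun c : k => algebraMap k K c ^ p) ∪ (G₂ : Set K)) := by
    rw [← hG₂, Algebra.adjoin_eq_ring_closure]
    congr 1
    ext x
    simp only [Set.mem_union, Set.mem_range]
    constructor
    · rintro (⟨c, rfl⟩ | hx)
      · obtain ⟨d, hd⟩ := RingHom.mem_fieldRange.mp c.2
        refine Or.inl ⟨d, ?_⟩
        rw [← map_pow, ← frobenius_def, hd, halg₀]
      · exact Or.inr hx
    · rintro (⟨c, rfl⟩ | hx)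
      · refine Or.inl ⟨⟨c ^ p, RingHom.mem_fieldRange.mpr ⟨c, frobenius_def _ _⟩⟩, ?_⟩
        rw [halg₀, map_pow]
      · exact Or.inr hx
  have hG₂O : ∀ g ∈ G₂, g ∈ O := fun g hg =>
    hA₂O (show g ∈ A₂ by rw [← hG₂]; exact Algebra.subset_adjoin hg)
  have hApC : ∀ a ∈ A, a ^ p ∈ A₂.toSubring := fun a ha => hAp a ha
  refine ⟨G₂, A₂.toSubring, hG₂O, hC, hApC, hR₂M, fun i => (z₂ i : K), fun i => (z₂ i).2, ?_, hz0, ?_, ?_⟩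
  · intro i
    have hi : z₂ i ∈ maximalIdeal _ := by rw [← hspan₂]; exact Ideal.subset_span ⟨i, rfl⟩
    exact (mem_maximalIdeal_locAtCentre_iff hA₂O _).mp hi
  · intro r hr hvr
    have hm : (⟨r, hr⟩ : locAtCentre A₂.toSubring O) ∈ maximalIdeal _ :=
      (mem_maximalIdeal_locAtCentre_iff hA₂O _).mpr hvr
    rw [← hspan₂, Ideal.mem_span_range_iff_exists_fun] at hm
    obtain ⟨b, hb⟩ := hm
    refine ⟨fun i => (b i : K), fun i => (b i).2, ?_⟩
    have h := congrArg (fun w : locAtCentre A₂.toSubring O => (w : K)) hb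
    simp only at h
    rw [← h]
    push_cast
    rfl
  · intro f hf
    obtain ⟨ε, e, hε, hεv, hfe⟩ := hfac f hf
    exact ⟨ε, e, hε, hεv, hfe⟩

/-! ## §F∞ The base change `T⁺ = Σ_s b_s T` for an ARBITRARY `p`-spanning family (finitely supported sums; new) -/

end Summit.ResolutionOfSingularities.ResolutionOfSingularities.Theorems.RadicialJungCleanModels.Lens5TFrame

end
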